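import Summits.ValiantsHypothesis.ValiantsHypothesis.Theorems.KPlusLogSqLawValuativeDoorVirtual
import Literature.Combinatorics.Optimization.ParametricShortestPath
import Literature.Computability.AlgebraicComplexity.DeterminantUniversalityBCSProofs

/-!
# LINE `valuative_door` (crux `WeakLifting`, stmt-ValiantsHypothesis-19561) — lane `…RankOneLawFalse`, file 2/3: the PATH POLYNOMIAL of a
# naturally weighted parametric DAG is a lacunary matrix determinant, and every strict leader gives a dominant exponent

HONEST FRAMING.  Helper (cell `pub-symmetroid`, seat val-sym-lift-p1 g22, 2026-08-29; `--supports 19561 --as helper`).  For a parametric DAG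
`G` on `k + 1` vertices with NATURAL intercepts `a` and slopes `b`, the path polynomial `g = Σ_{P : s–t path} 2^{a(P)} X^{b(P)} ∈ ℝ[X]`
(1) IS the determinant of the tree's lower-Hessenberg matrix `hessNeg k` over `ℝ[X]` with labels `C(2^{a_e}) X^{b_e}` (`det_hessNeg` +
`ParamDAG.pathSum_labelsNat_eq_sum_paths`, both landed: Valiant / BCS (21.28) and the Part VI bridge), and that matrix IS a general lacunary
matrix pencil `Σ_{l<K} X^{d_l} M_l` with `K ≤ (k+1)² + 1` letters = the distinct slope values and `0` (`exists_pencil_eq_hessNeg`); (2) for every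
absolute value `w` on `ℝ` that is non-archimedean with `w 2 < 1` (the kernel `twoAdicOnReals`), every path `P_j` that is STRICTLY cheapest at
some parameter `u_j` makes its slope `b(P_j)` a DOMINANT exponent of `g` at the radius `(w 2)^{u_j}`: in its slope class its intercept is the
unique minimum (costs are compared at equal slope), so `w(c_{b(P_j)}) = (w 2)^{a(P_j)}` by the strict ultrametric inequality
(`abv_sum_eq_of_unique_max`), and every other class is bounded by its cheapest path, which costs more (`le_card_dominant_pathPoly`: the number
of dominant exponents is at least the number of strict leaders).  Consumed by file 3/3.  No statement about the line's candidates here; closes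
nothing; 19561 / 18050 / VP ≠ VNP untouched.  [Valiant 1979 / BCS 1997 (21.28); elementary ultrametric bookkeeping]
-/

set_option linter.dupNamespace false
set_option autoImplicit false

namespace Summit.ValiantsHypothesis.ValiantsHypothesis.Theorems.KPlusLogSqLaw.ValDoor

open Polynomial Finset Matrix
open scoped BigOperators Classical
open Literature.Combinatorics.Optimization
open Literature.Combinatorics.Optimization.ParamDAG
open Literature.Computability.AlgebraicComplexity (hessNeg det_hessNeg pathSum)

variable {k : ℕ}

/-! ## §1 The path polynomial as a Hessenberg determinant -/

/-- the weight of a path under the labels `C(2^{a_e}) X^{b_e}` is `C(2^{a(P)}) X^{b(P)}`. [bookkeeping] -/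
theorem prodLabels_pow_labels (G : ParamDAG k) (a b : Fin (k + 1) → Fin (k + 1) → ℕ) (P : G.Path) :
    P.prodLabels (fun u v => Polynomial.C ((2 : ℝ) ^ a u v) * (Polynomial.X : Polynomial ℝ) ^ b u v)
      = Polynomial.C ((2 : ℝ) ^ ∑ c : Fin P.len, a (P.verts c.castSucc) (P.verts c.succ)) *
          (Polynomial.X : Polynomial ℝ) ^ ∑ c : Fin P.len, b (P.verts c.castSucc) (P.verts c.succ) := by
  unfold PathTo.prodLabels
  rw [Finset.prod_mul_distrib, Finset.prod_pow_eq_pow_sum, ← map_prod, Finset.prod_pow_eq_pow_sum]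

/-- **the path polynomial is a Hessenberg determinant:** `det (hessNeg k (labels)) = Σ_P C(2^{a(P)}) X^{b(P)}`.
[`det_hessNeg` + `pathSum_labelsNat_eq_sum_paths`] -/
theorem det_hessNeg_labels (G : ParamDAG k) (a b : Fin (k + 1) → Fin (k + 1) → ℕ) :
    (hessNeg k (G.labelsNat fun u v => Polynomial.C ((2 : ℝ) ^ a u v) * (Polynomial.X : Polynomial ℝ) ^ b u v)).det
      = ∑ P : G.Path, Polynomial.C ((2 : ℝ) ^ ∑ c : Fin P.len, a (P.verts c.castSucc) (P.verts c.succ)) *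
          (Polynomial.X : Polynomial ℝ) ^ ∑ c : Fin P.len, b (P.verts c.castSucc) (P.verts c.succ) := by
  rw [det_hessNeg, pathSum_labelsNat_eq_sum_paths]
  exact Finset.sum_congr rfl fun P _ => prodLabels_pow_labels G a b P

/-- **the Hessenberg matrix is a lacunary matrix pencil** with at most `(k+1)² + 1` letters (the distinct slope values and `0`).
[bookkeeping] -/
theorem exists_pencil_eq_hessNeg (G : ParamDAG k) (a b : Fin (k + 1) → Fin (k + 1) → ℕ) :
    ∃ (K : ℕ) (d : Fin K → ℕ) (M : Fin K → Matrix (Fin k) (Fin k) ℝ), K ≤ (k + 1) ^ 2 + 1 ∧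
      hessNeg k (G.labelsNat fun u v => Polynomial.C ((2 : ℝ) ^ a u v) * (Polynomial.X : Polynomial ℝ) ^ b u v)
        = ∑ l, ((Polynomial.X : Polynomial ℝ) ^ d l) • (M l).map Polynomial.C := by
  -- the letters: distinct slope values together with 0
  set vals : Finset ℕ := insert 0 ((univ : Finset (Fin (k + 1) × Fin (k + 1))).image fun p => b p.1 p.2) with hvals
  set K : ℕ := vals.card with hK
  set d : Fin K → ℕ := fun l => vals.orderEmbOfFin rfl l with hd
  have hd_inj : Function.Injective d := (vals.orderEmbOfFin rfl).injective
  have hd_mem : ∀ x, x ∈ vals ↔ ∃ l, d l = x := by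
    intro x
    constructor
    · intro hx
      have : x ∈ Set.range (vals.orderEmbOfFin rfl) := by rw [Finset.range_orderEmbOfFin]; exact hx
      obtain ⟨l, hl⟩ := this
      exact ⟨l, hl⟩
    · rintro ⟨l, rfl⟩
      exact Finset.orderEmbOfFin_mem vals rfl l
  obtain ⟨l₀, hl₀⟩ := (hd_mem 0).1 (Finset.mem_insert_self _ _)
  have hbl : ∀ u v, ∃ l, d l = b u v := fun u v =>
    (hd_mem _).1 (Finset.mem_insert_of_mem (Finset.mem_image.2 ⟨(u, v), Finset.mem_univ _, rfl⟩))
  -- the letter matrices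
  set M : Fin K → Matrix (Fin k) (Fin k) ℝ := fun l r c =>
    if r.val = c.val + 1 then (if d l = 0 then -1 else 0)
    else if r.val ≤ c.val then
      (if G.adj ⟨r.val, by omega⟩ ⟨c.val + 1, by omega⟩ ∧ b ⟨r.val, by omega⟩ ⟨c.val + 1, by omega⟩ = d l
        then (2 : ℝ) ^ a ⟨r.val, by omega⟩ ⟨c.val + 1, by omega⟩ else 0)
    else 0 with hM
  refine ⟨K, d, M, ?_, ?_⟩
  · -- K ≤ (k+1)² + 1
    calc K = vals.card := hK
      _ ≤ ((univ : Finset (Fin (k + 1) × Fin (k + 1))).image fun p => b p.1 p.2).card + 1 := Finset.card_insert_le _ _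
      _ ≤ (univ : Finset (Fin (k + 1) × Fin (k + 1))).card + 1 := Nat.add_le_add_right Finset.card_image_le 1
      _ = (k + 1) ^ 2 + 1 := by rw [Finset.card_univ, Fintype.card_prod, Fintype.card_fin]; ring
  · ext r c
    rw [Matrix.sum_apply]
    simp only [Matrix.smul_apply, Matrix.map_apply, smul_eq_mul]
    unfold hessNeg
    by_cases hrc : r.val = c.val + 1
    · -- subdiagonal: −1, carried by the letter of slope value 0
      simp only [hrc, if_true, hM]
      rw [Finset.sum_eq_single l₀]
      · rw [if_pos hl₀, hl₀, pow_zero, one_mul, map_neg, map_one]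
      · intro l _ hl
        rw [if_neg (fun h => hl (hd_inj (h.trans hl₀.symm))), map_zero, mul_zero]
      · intro h; exact absurd (Finset.mem_univ _) h
    · by_cases hle : r.val ≤ c.val
      · simp only [hrc, if_false, hle, if_true, hM]
        have hr : r.val < k + 1 := by omega
        have hc : c.val + 1 < k + 1 := by omega
        rw [ParamDAG.labelsNat, dif_pos ⟨hr, hc⟩]
        obtain ⟨l₁, hl₁⟩ := hbl ⟨r.val, hr⟩ ⟨c.val + 1, hc⟩
        rw [Finset.sum_eq_single l₁]
        · by_cases hadj : G.adj ⟨r.val, hr⟩ ⟨c.val + 1, hc⟩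
          · rw [if_pos hadj, if_pos ⟨hadj, hl₁.symm⟩, hl₁, mul_comm]
          · rw [if_neg hadj, if_neg (fun h => hadj h.1), map_zero, mul_zero]
        · intro l _ hl
          rw [if_neg (fun h => hl (hd_inj (h.2.symm.trans hl₁.symm))), map_zero, mul_zero]
        · intro h; exact absurd (Finset.mem_univ _) h
      · simp only [hrc, if_false, hle, hM, map_zero, mul_zero, Finset.sum_const_zero]

/-! ## §2 Strict leaders are dominant exponents -/

/-- the cost line of a path with natural weights: `cost(P)(μ) = a(P) + b(P)·μ`. [bookkeeping] -/
theorem cost_eq_natCast (G : ParamDAG k) (a b : Fin (k + 1) → Fin (k + 1) → ℕ) (hwa : ∀ u v, G.wa u v = a u v)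
    (hwb : ∀ u v, G.wb u v = b u v) (P : G.Path) (μ : ℝ) :
    P.cost μ = ((∑ c : Fin P.len, a (P.verts c.castSucc) (P.verts c.succ) : ℕ) : ℝ)
      + ((∑ c : Fin P.len, b (P.verts c.castSucc) (P.verts c.succ) : ℕ) : ℝ) * μ := by
  rw [Path.cost_eq]
  unfold Path.icpt Path.slope
  simp only [hwa, hwb]
  push_cast
  rfl

/-- the coefficient of the path polynomial at `E`: the sum of `2^{a(P)}` over the paths of slope `E`. [bookkeeping] -/
theorem coeff_pathPoly (G : ParamDAG k) (a b : Fin (k + 1) → Fin (k + 1) → ℕ) (E : ℕ) :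
    (∑ P : G.Path, Polynomial.C ((2 : ℝ) ^ ∑ c : Fin P.len, a (P.verts c.castSucc) (P.verts c.succ)) *
        (Polynomial.X : Polynomial ℝ) ^ ∑ c : Fin P.len, b (P.verts c.castSucc) (P.verts c.succ)).coeff E
      = ∑ P ∈ (univ : Finset G.Path).filter (fun P => ∑ c : Fin P.len, b (P.verts c.castSucc) (P.verts c.succ) = E),
          (2 : ℝ) ^ ∑ c : Fin P.len, a (P.verts c.castSucc) (P.verts c.succ) := by
  rw [Polynomial.finsetSum_coeff]
  simp only [Polynomial.coeff_C_mul_X_pow]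
  rw [Finset.sum_filter]
  refine Finset.sum_congr rfl fun P _ => ?_
  by_cases h : ∑ c : Fin P.len, b (P.verts c.castSucc) (P.verts c.succ) = E
  · rw [if_pos h, if_pos h.symm]
  · rw [if_neg h, if_neg (fun h' => h h'.symm)]

/-- **STRICT LEADERS ARE DOMINANT** (the count): if `N` source–sink paths `P_j` of a naturally weighted DAG are each STRICTLY cheapest at some
parameter `u_j`, then for every non-archimedean absolute value `w` on `ℝ` with `w 2 < 1` the path polynomial `Σ_P 2^{a(P)} X^{b(P)}` has at
least `N` dominant exponents (in the skeleton's unfolded `domCount` currency). [elementary ultrametric bookkeeping] -/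
theorem le_card_dominant_pathPoly (G : ParamDAG k) (a b : Fin (k + 1) → Fin (k + 1) → ℕ) (hwa : ∀ u v, G.wa u v = a u v)
    (hwb : ∀ u v, G.wb u v = b u v) {N : ℕ} (P : Fin N → G.Path) (hP : Function.Injective P) (u : Fin N → ℝ)
    (hlead : ∀ (j : Fin N) (Q : G.Path), Q ≠ P j → (P j).cost (u j) < Q.cost (u j))
    (w : AbsoluteValue ℝ ℝ) (hw : IsNonarchimedean w) (hw2 : w 2 < 1) :
    N ≤ ((∑ P : G.Path, Polynomial.C ((2 : ℝ) ^ ∑ c : Fin P.len, a (P.verts c.castSucc) (P.verts c.succ)) *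
        (Polynomial.X : Polynomial ℝ) ^ ∑ c : Fin P.len, b (P.verts c.castSucc) (P.verts c.succ)).support.filter fun E =>
        ∃ r : ℝ, 0 < r ∧ ∀ E' ∈ (∑ P : G.Path, Polynomial.C ((2 : ℝ) ^ ∑ c : Fin P.len, a (P.verts c.castSucc) (P.verts c.succ)) *
          (Polynomial.X : Polynomial ℝ) ^ ∑ c : Fin P.len, b (P.verts c.castSucc) (P.verts c.succ)).support, E' ≠ E →
          w ((∑ P : G.Path, Polynomial.C ((2 : ℝ) ^ ∑ c : Fin P.len, a (P.verts c.castSucc) (P.verts c.succ)) *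
            (Polynomial.X : Polynomial ℝ) ^ ∑ c : Fin P.len, b (P.verts c.castSucc) (P.verts c.succ)).coeff E') * r ^ E'
          < w ((∑ P : G.Path, Polynomial.C ((2 : ℝ) ^ ∑ c : Fin P.len, a (P.verts c.castSucc) (P.verts c.succ)) *
            (Polynomial.X : Polynomial ℝ) ^ ∑ c : Fin P.len, b (P.verts c.castSucc) (P.verts c.succ)).coeff E) * r ^ E).card := by
  set A : G.Path → ℕ := fun P => ∑ c : Fin P.len, a (P.verts c.castSucc) (P.verts c.succ) with hA
  set B : G.Path → ℕ := fun P => ∑ c : Fin P.len, b (P.verts c.castSucc) (P.verts c.succ) with hB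
  set f : Polynomial ℝ := ∑ P : G.Path, Polynomial.C ((2 : ℝ) ^ A P) * (Polynomial.X : Polynomial ℝ) ^ B P with hf
  set D := f.support.filter fun E => ∃ r : ℝ, 0 < r ∧ ∀ E' ∈ f.support, E' ≠ E →
      w (f.coeff E') * r ^ E' < w (f.coeff E) * r ^ E with hD
  set θ : ℝ := w 2 with hθ
  have hθpos : 0 < θ := w.pos two_ne_zero
  have hcost : ∀ (Q : G.Path) (μ : ℝ), Q.cost μ = (A Q : ℝ) + (B Q : ℝ) * μ := fun Q μ => cost_eq_natCast G a b hwa hwb Q μ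
  have hcoeff : ∀ E, f.coeff E = ∑ Q ∈ (univ : Finset G.Path).filter (fun Q => B Q = E), (2 : ℝ) ^ A Q :=
    fun E => coeff_pathPoly G a b E
  -- a strict leader has the unique minimal intercept in its slope class
  have hAlt : ∀ (j : Fin N) (Q : G.Path), Q ≠ P j → B Q = B (P j) → A (P j) < A Q := by
    intro j Q hQ hBQ
    have h := hlead j Q hQ
    rw [hcost, hcost, hBQ] at h
    have : (A (P j) : ℝ) < A Q := by linarith
    exact_mod_cast this
  -- the class coefficient of a leader has the leader's size
  have hsize : ∀ j : Fin N, w (f.coeff (B (P j))) = θ ^ A (P j) := by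
    intro j
    rw [hcoeff]
    have hmem : P j ∈ (univ : Finset G.Path).filter (fun Q => B Q = B (P j)) := Finset.mem_filter.2 ⟨Finset.mem_univ _, rfl⟩
    rw [abv_sum_eq_of_unique_max w hw _ (fun Q => (2 : ℝ) ^ A Q) hmem, map_pow]
    intro Q hQ hQne
    rw [map_pow, map_pow]
    exact pow_right_strictAnti₀ hθpos hw2 (hAlt j Q hQne (Finset.mem_filter.1 hQ).2)
  have hsupp : ∀ j : Fin N, B (P j) ∈ f.support := by
    intro j
    rw [Polynomial.mem_support_iff, ← w.pos_iff, hsize]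
    exact pow_pos hθpos _
  -- each leader's slope is dominant at radius θ^{u j}
  have hdom : ∀ j : Fin N, B (P j) ∈ D := by
    intro j
    refine Finset.mem_filter.2 ⟨hsupp j, θ ^ (u j), Real.rpow_pos_of_pos hθpos _, fun E' hE' hne => ?_⟩
    -- a path of class E' bounding its coefficient
    have hE'0 := Polynomial.mem_support_iff.1 hE'
    have hCne : ((univ : Finset G.Path).filter (fun Q => B Q = E')).Nonempty := by
      rw [Finset.nonempty_iff_ne_empty]
      intro h
      rw [hcoeff E', h, Finset.sum_empty] at hE'0
      exact hE'0 rfl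
    obtain ⟨Q, hQ, hle⟩ := IsNonarchimedean.finset_image_add_of_nonempty hw (fun Q => (2 : ℝ) ^ A Q) hCne
    have hBQ : B Q = E' := (Finset.mem_filter.1 hQ).2
    have hQne : Q ≠ P j := fun h => hne (by rw [← hBQ, h])
    have hlt := hlead j Q hQne
    rw [hcost, hcost] at hlt
    rw [← hcoeff E', map_pow] at hle
    -- sizes as real powers of θ
    have e1 : w (f.coeff E') * (θ ^ (u j)) ^ E' ≤ θ ^ ((A Q : ℝ) + (B Q : ℝ) * u j) := by
      rw [Real.rpow_add hθpos, Real.rpow_natCast, mul_comm ((B Q : ℕ) : ℝ), Real.rpow_mul hθpos.le, Real.rpow_natCast, hBQ]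
      exact mul_le_mul_of_nonneg_right hle (pow_nonneg (Real.rpow_pos_of_pos hθpos _).le _)
    have e2 : w (f.coeff (B (P j))) * (θ ^ (u j)) ^ B (P j) = θ ^ ((A (P j) : ℝ) + (B (P j) : ℝ) * u j) := by
      rw [hsize, Real.rpow_add hθpos, Real.rpow_natCast, mul_comm ((B (P j) : ℕ) : ℝ), Real.rpow_mul hθpos.le, Real.rpow_natCast]
    rw [e2]
    exact lt_of_le_of_lt e1 (Real.rpow_lt_rpow_of_exponent_gt hθpos hw2 hlt)
  -- distinct leaders have distinct slopes
  have hinj : Function.Injective fun j : Fin N => B (P j) := by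
    intro j j' h
    by_contra hjj
    have hne : P j' ≠ P j := fun hPP => hjj (hP hPP).symm
    have h1 := hAlt j (P j') hne h.symm
    have h2 := hAlt j' (P j) (Ne.symm hne) h
    omega
  calc N = (univ : Finset (Fin N)).card := by rw [Finset.card_univ, Fintype.card_fin]
    _ ≤ D.card := Finset.card_le_card_of_injOn (fun j => B (P j)) (fun j _ => hdom j) (hinj.injOn)

end Summit.ValiantsHypothesis.ValiantsHypothesis.Theorems.KPlusLogSqLaw.ValDoor
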